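/-
Copyright (c) 2026 the pub-hodgecm-mathlib formalisation cell (harness21).  Prover seat hodgecm-mathlib-K2E3-p17 (g8), Track B «K2-LIT» ∕ h413
(`stmt-HodgeConjecture-24833`), line `K2_E3_EllipticInputs`, leaf (nsc-S-A′), D94 sub-brick S3′ «STAGES-θ′» (the `Q′ = P₁₂` twin of ★ S3 p859956) for C1′ (`hC1low` of ★ ASM
p859901) via ★ (lev) p859300.  2026-09-04.
-/
import Summits.HodgeConjecture.HodgeConjecture.Theorems.K2E3GL3JacquetInStagesBorelPrime   -- ★ BRIDGE′ (K2E3-p14 g7): `ι′ = mulSingle true ∘ reindexGL e`, `normalizedJacquetGL_blockEmbedding_mk_of_mem_unipotentRadicalGL`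
import Summits.HodgeConjecture.HodgeConjecture.Theorems.K2E3CoinvariantsInStages             -- ★ LEV-2 §1 (K2E5-p17): `ker_charTwist_eq_sup`
import Summits.HodgeConjecture.HodgeConjecture.Theorems.K2E3GL3UnipotentCharactersPrime      -- ★∕📤 (this seat): `unipotentRadical12_sup_rootGroup_eq`, `mem_unipotentRadical12_iff`, `coe_eq_of_mem_rootGroup12`
import Summits.HodgeConjecture.HodgeConjecture.Theorems.K2E3GL3DegenerateStagesCriterion      -- ★ S3 (this seat): `whittakerCharFun_two`, `transvectionUnit_zero_one_mem_unipotentRadicalGL_two` (reused, not restated)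
import HarnessLib

/-!
# Crux `H413` — leaf (nsc-S-A′), sub-brick STAGES-θ′: `ω` IS `ψ′`-DEGENERATE IFF THE `GL₂`-PART OF `r_{Q′} ω` HAS NO `ψ`-WHITTAKER JACQUET MODULE

Cell `hodgecm-mathlib`, Track B; THEOREMS ONLY; count-neutral helper (`--supports stmt-HodgeConjecture-24833 --as helper`).  The `P₁₂`-twin of ★ `K2E3GL3DegenerateStagesCriterion`:
`Q′ = standardParabolicGL F ![false,true,true]`, `U_{Q′}`, `U_{α₂} = unipotentRadicalGL F id ⊓ standardLeviGL F ![false,true,true]`, ★ BRIDGE′'s `GL₂`-part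
`W′ := (normalizedJacquetGL F ![false,true,true] V) ∘ ι′`, `ι′ = mulSingle true ∘ reindexGL e` (`e`, `he : e j = Fin.succ j`), and `θ′(u) = ψ(u₁₂)` — the character of ★ (lev).

THE CRITERION **`forall_mk_charTwist_eq_zero_iff_whittaker_gl2'`**: `(∀ v, [v]_{U₃,θ′} = 0) ↔ (∀ w, [w]_{U₂,ψ} = 0 in J_ψ(W′))`.  Proof as for `Q`: `V(U₃,θ′) = V(U_{Q′}) + V(U_{α₂},ψ∘u₁₂)`
(★ LEV-2 `ker_charTwist_eq_sup`, ★∕📤 `unipotentRadical12_sup_rootGroup_eq`, `θ′|_{U_{Q′}} = 1`); `U_{α₂} = ι′(U₂)` entrywise (§1); the `(U₂,ψ)`-kernel of `W′` on `r_{Q′} V` is the image of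
`V(U_{α₂},ψ∘u₁₂)` (★ BRIDGE′ `normalizedJacquetGL_blockEmbedding_mk_of_mem_unipotentRadicalGL`).

HONEST LABEL: HC_CM is proved only modulo the 7 printed citations (2 remaining named inputs: hLiu418 = stmt-HodgeConjecture-24832, h413 =
stmt-HodgeConjecture-24833) until rung 0 closes; count-neutral helper.

## References
* [BernsteinZelevinskyASENS1977] I. N. Bernstein, A. V. Zelevinsky, *Induced representations of reductive p-adic groups I*, Ann. Sci. ÉNS 10 (1977), §1.8 (b), §1.9 (c), §2.1.
* [Zelevinsky1980] A. V. Zelevinsky, *Induced representations of reductive p-adic groups II*, Ann. Sci. ÉNS 13 (1980), §3.7.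
-/

set_option autoImplicit false
-- the mandated namespace repeats `HodgeConjecture.HodgeConjecture`, as in every `Theorems/*.lean` of this sub-problem
set_option linter.dupNamespace false

noncomputable section

open Representation Function Literature.NumberTheory.Automorphic Literature.NumberTheory.GaloisRepresentations.IsNonarchimedeanLocalField
open scoped MatrixGroups
open Summit.HodgeConjecture.HodgeConjecture.Cruxes.H413.K2E3GL3OneTwoLeviBookkeeping (blockEmbedding_apply_succ blockEmbedding_apply_zero_zero blockEmbedding_apply_zero_succ
  blockEmbedding_apply_succ_zero)
open Summit.HodgeConjecture.HodgeConjecture.Cruxes.H413.K2E3GL3JacquetInStagesBorelPrime (blockDiagonalGL_mulSingle_true_mem_unipotentRadicalGL normalizedJacquetGL_blockEmbedding_mk_of_mem_unipotentRadicalGL)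
open Summit.HodgeConjecture.HodgeConjecture.Cruxes.H413.K2E3CoinvariantsInStages (ker_charTwist_eq_sup)
open Summit.HodgeConjecture.HodgeConjecture.Cruxes.H413.K2E3GL3UnipotentCharacters (entries_of_mem_upperUnitriangular)
open Summit.HodgeConjecture.HodgeConjecture.Cruxes.H413.K2E3GL3UnipotentCharactersPrime (unipotentRadical12_sup_rootGroup_eq unipotentRadical12_le mem_unipotentRadical12_iff
  coe_eq_of_mem_rootGroup12)
open Summit.HodgeConjecture.HodgeConjecture.Cruxes.H413.K2E3GL3DegenerateStagesCriterion (whittakerCharFun_two transvectionUnit_zero_one_mem_unipotentRadicalGL_two)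

namespace Summit.HodgeConjecture.HodgeConjecture.Cruxes.H413.K2E3GL3DegenerateStagesCriterionPrime

/-! ## §1 `U_{α₂} = ι′(U₂)` -/

section Entries

variable {F : Type*} [Field F]
  (e : Fin 2 ≃ {i : Fin 3 // (![false, true, true] : Fin 3 → Bool) i = true})
  (he : ∀ j : Fin 2, ((e j : {i : Fin 3 // (![false, true, true] : Fin 3 → Bool) i = true}) : Fin 3) = Fin.succ j)

include he in
/-- **Entries of `ι′(x₀₁(t))`**: `ι′(1 + t E₀₁) = 1 + t E₁₂` in `GL₃`. [cite: BernsteinZelevinskyASENS1977, §2.1] -/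
theorem coe_blockEmbedding_transvectionUnit (t : F) :
    ((((leviEmbeddingP F (![false, true, true] : Fin 3 → Bool) (Pi.mulSingle (M := (fun a : Bool => GL {i : Fin 3 // (![false, true, true] : Fin 3 → Bool) i = a} F)) true (reindexGL e (transvectionUnit 0 1 (by decide) t)))) : ↥(standardParabolicGL F (![false, true, true] : Fin 3 → Bool))) : GL (Fin 3) F) : Matrix (Fin 3) (Fin 3) F) = 1 + Matrix.single 1 2 t := by
  have hss : ∀ i j : Fin 2, ((((leviEmbeddingP F (![false, true, true] : Fin 3 → Bool) (Pi.mulSingle (M := (fun a : Bool => GL {i : Fin 3 // (![false, true, true] : Fin 3 → Bool) i = a} F)) true (reindexGL e (transvectionUnit 0 1 (by decide) t)))) : ↥(standardParabolicGL F (![false, true, true] : Fin 3 → Bool))) : GL (Fin 3) F) : Matrix (Fin 3) (Fin 3) F) (Fin.succ i) (Fin.succ j) =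
      (1 + Matrix.single 0 1 t : Matrix (Fin 2) (Fin 2) F) i j := fun i j => by
    rw [blockEmbedding_apply_succ e he, coe_transvectionUnit]
  have h0s : ∀ j : Fin 2, ((((leviEmbeddingP F (![false, true, true] : Fin 3 → Bool) (Pi.mulSingle (M := (fun a : Bool => GL {i : Fin 3 // (![false, true, true] : Fin 3 → Bool) i = a} F)) true (reindexGL e (transvectionUnit 0 1 (by decide) t)))) : ↥(standardParabolicGL F (![false, true, true] : Fin 3 → Bool))) : GL (Fin 3) F) : Matrix (Fin 3) (Fin 3) F) 0 (Fin.succ j) = 0 :=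
    fun j => blockEmbedding_apply_zero_succ e _ j
  have hs0 : ∀ i : Fin 2, ((((leviEmbeddingP F (![false, true, true] : Fin 3 → Bool) (Pi.mulSingle (M := (fun a : Bool => GL {i : Fin 3 // (![false, true, true] : Fin 3 → Bool) i = a} F)) true (reindexGL e (transvectionUnit 0 1 (by decide) t)))) : ↥(standardParabolicGL F (![false, true, true] : Fin 3 → Bool))) : GL (Fin 3) F) : Matrix (Fin 3) (Fin 3) F) (Fin.succ i) 0 = 0 :=
    fun i => blockEmbedding_apply_succ_zero e _ i
  have h00 := blockEmbedding_apply_zero_zero e (transvectionUnit (0 : Fin 2) 1 (by decide) t)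
  ext i j
  fin_cases i <;> fin_cases j
  · exact h00.trans (by simp)
  · exact (h0s 0).trans (by simp)
  · exact (h0s 1).trans (by simp)
  · exact (hs0 0).trans (by simp)
  · exact (hss 0 0).trans (by simp)
  · exact (hss 0 1).trans (by simp)
  · exact (hs0 1).trans (by simp)
  · exact (hss 1 0).trans (by simp)
  · exact (hss 1 1).trans (by simp)

include he in
/-- **`U_{α₂} = ι′(U₂)`, pointwise**: every root-group element is `ι′(x₀₁(t))`, `t` its `(1,2)` entry. [cite: BernsteinZelevinskyASENS1977, §2.1] -/
theorem eq_blockEmbedding_transvectionUnit_of_mem_rootGroup {h : GL (Fin 3) F} (hh : h ∈ (unipotentRadicalGL F (id : Fin 3 → Fin 3) ⊓ standardLeviGL F ![false, true, true])) :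
    h = (((leviEmbeddingP F (![false, true, true] : Fin 3 → Bool) (Pi.mulSingle (M := (fun a : Bool => GL {i : Fin 3 // (![false, true, true] : Fin 3 → Bool) i = a} F)) true (reindexGL e (transvectionUnit 0 1 (by decide) ((h : Matrix (Fin 3) (Fin 3) F) 1 2))))) : ↥(standardParabolicGL F (![false, true, true] : Fin 3 → Bool))) : GL (Fin 3) F) :=
  Units.ext (by rw [coe_blockEmbedding_transvectionUnit e he]; exact coe_eq_of_mem_rootGroup12 hh)

include he in
/-- `ι′(k) ∈ U_{α₂}` for `k ∈ U₂` (★ BRIDGE′ gives `∈ U₃`; the Levi part is the range of `leviEmbedding`). [cite: BernsteinZelevinskyASENS1977, §2.1] -/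
theorem blockEmbedding_mem_rootGroup (k : GL (Fin 2) F) (hk : k ∈ unipotentRadicalGL F (id : Fin 2 → Fin 2)) :
    (((leviEmbeddingP F (![false, true, true] : Fin 3 → Bool) (Pi.mulSingle (M := (fun a : Bool => GL {i : Fin 3 // (![false, true, true] : Fin 3 → Bool) i = a} F)) true (reindexGL e k))) : ↥(standardParabolicGL F (![false, true, true] : Fin 3 → Bool))) : GL (Fin 3) F) ∈ (unipotentRadicalGL F (id : Fin 3 → Fin 3) ⊓ standardLeviGL F ![false, true, true]) := by
  refine ⟨?_, ?_⟩
  · rw [coe_leviEmbeddingP]; exact blockDiagonalGL_mulSingle_true_mem_unipotentRadicalGL e he k hk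
  · rw [coe_leviEmbeddingP]; exact ⟨_, leviEmbedding_apply (![false, true, true] : Fin 3 → Bool) _⟩

include he in
/-- The `(1,2)` entry of `ι′(k)` is `k₀₁`. [folklore] -/
theorem blockEmbedding_apply_one_two (k : GL (Fin 2) F) :
    ((((leviEmbeddingP F (![false, true, true] : Fin 3 → Bool) (Pi.mulSingle (M := (fun a : Bool => GL {i : Fin 3 // (![false, true, true] : Fin 3 → Bool) i = a} F)) true (reindexGL e k))) : ↥(standardParabolicGL F (![false, true, true] : Fin 3 → Bool))) : GL (Fin 3) F) : Matrix (Fin 3) (Fin 3) F) 1 2 = ((k : GL (Fin 2) F) : Matrix (Fin 2) (Fin 2) F) 0 1 :=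
  blockEmbedding_apply_succ e he k 0 1

end Entries

/-! ## §2 The kernels: `V(U_{Q′})`, `V(U_{α₂}, ψ∘u₁₂)`, and the `(U₂,ψ)`-kernel of the `GL₂`-part -/

section Kernels

variable {F : Type*} [Field F] [ValuativeRel F] [TopologicalSpace F] [IsNonarchimedeanLocalField F]
  (e : Fin 2 ≃ {i : Fin 3 // (![false, true, true] : Fin 3 → Bool) i = true})
  (he : ∀ j : Fin 2, ((e j : {i : Fin 3 // (![false, true, true] : Fin 3 → Bool) i = true}) : Fin 3) = Fin.succ j)
  {X : Type*} [AddCommGroup X] [Module ℂ X] (V : Representation ℂ (GL (Fin 3) F) X) {ψ : AddChar F Circle}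

omit [ValuativeRel F] [TopologicalSpace F] [IsNonarchimedeanLocalField F] in
/-- `V(U_{Q′})` in the two spellings (★ `restrictUnipotentGL` kernel vs. restriction to the image subgroup). [folklore] -/
theorem ker_restrictUnipotentGL_eq_ker_comp_subtype :
    Coinvariants.ker (restrictUnipotentGL F (![false, true, true] : Fin 3 → Bool) V) = Coinvariants.ker (V.comp (unipotentRadicalGL F (![false, true, true] : Fin 3 → Bool)).subtype) := by
  refine le_antisymm (Submodule.span_mono ?_) (Submodule.span_mono ?_)
  · rintro _ ⟨⟨u, x⟩, rfl⟩
    exact ⟨(⟨((u : ↥(standardParabolicGL F (![false, true, true] : Fin 3 → Bool))) : GL (Fin 3) F), ⟨u, u.2, rfl⟩⟩, x), rfl⟩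
  · rintro _ ⟨⟨g, x⟩, rfl⟩
    obtain ⟨u, hu, hug⟩ := g.2
    refine ⟨(⟨u, hu⟩, x), ?_⟩
    show (restrictUnipotentGL F (![false, true, true] : Fin 3 → Bool) V) ⟨u, hu⟩ x - x = V (g : GL (Fin 3) F) x - x
    rw [← hug]
    rfl

omit [ValuativeRel F] [TopologicalSpace F] [IsNonarchimedeanLocalField F] in
include he in
/-- **`V(U_{α₂}, ψ∘u₁₂) = ⟨V(ι′ k) x − ψ_U(k) x : k ∈ U₂⟩`.** [cite: BernsteinZelevinskyASENS1977, §1.8 (b)] -/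
theorem ker_charTwist_rootGroup_eq_span (θ' : ↥(upperUnitriangular (Fin 3) F) →* ℂˣ) (hθ' : ∀ u, ((θ' u : ℂˣ) : ℂ) = ψ (((u : GL (Fin 3) F) : Matrix (Fin 3) (Fin 3) F) 1 2))
    (hR : (unipotentRadicalGL F (id : Fin 3 → Fin 3) ⊓ standardLeviGL F ![false, true, true]) ≤ (upperUnitriangular (Fin 3) F)) :
    Coinvariants.ker (V.charTwist (unipotentRadicalGL F (id : Fin 3 → Fin 3) ⊓ standardLeviGL F ![false, true, true]) (θ'.comp (Subgroup.inclusion hR))) = (Submodule.span ℂ (Set.range fun p : ↥(upperUnitriangular (Fin 2) F) × X => V (((leviEmbeddingP F (![false, true, true] : Fin 3 → Bool) (Pi.mulSingle (M := (fun a : Bool => GL {i : Fin 3 // (![false, true, true] : Fin 3 → Bool) i = a} F)) true (reindexGL e (p.1 : GL (Fin 2) F)))) : ↥(standardParabolicGL F (![false, true, true] : Fin 3 → Bool))) : GL (Fin 3) F) p.2 - (whittakerChar ψ p.1 : ℂˣ) • p.2)) := by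
  rw [ker_charTwist_eq_span]
  have hval : ∀ (k : ↥(upperUnitriangular (Fin 2) F)) (hk : (((leviEmbeddingP F (![false, true, true] : Fin 3 → Bool) (Pi.mulSingle (M := (fun a : Bool => GL {i : Fin 3 // (![false, true, true] : Fin 3 → Bool) i = a} F)) true (reindexGL e (k : GL (Fin 2) F)))) : ↥(standardParabolicGL F (![false, true, true] : Fin 3 → Bool))) : GL (Fin 3) F) ∈ (unipotentRadicalGL F (id : Fin 3 → Fin 3) ⊓ standardLeviGL F ![false, true, true])),
      (θ'.comp (Subgroup.inclusion hR)) ⟨_, hk⟩ = whittakerChar ψ k := fun k hk => Units.ext (by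
    rw [MonoidHom.comp_apply, hθ', coe_whittakerChar, whittakerCharFun_two]
    exact congrArg (fun z : F => ((ψ z : Circle) : ℂ)) (blockEmbedding_apply_one_two e he (k : GL (Fin 2) F)))
  refine le_antisymm (Submodule.span_mono ?_) (Submodule.span_mono ?_)
  · rintro _ ⟨⟨h, x⟩, rfl⟩
    set k : GL (Fin 2) F := transvectionUnit 0 1 (by decide) (((h : GL (Fin 3) F) : Matrix (Fin 3) (Fin 3) F) 1 2) with hk
    have hkU : k ∈ (upperUnitriangular (Fin 2) F) := transvectionUnit_zero_one_mem_unipotentRadicalGL_two _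
    have hh : (h : GL (Fin 3) F) = (((leviEmbeddingP F (![false, true, true] : Fin 3 → Bool) (Pi.mulSingle (M := (fun a : Bool => GL {i : Fin 3 // (![false, true, true] : Fin 3 → Bool) i = a} F)) true (reindexGL e k))) : ↥(standardParabolicGL F (![false, true, true] : Fin 3 → Bool))) : GL (Fin 3) F) := eq_blockEmbedding_transvectionUnit_of_mem_rootGroup e he h.2
    have hmem : (((leviEmbeddingP F (![false, true, true] : Fin 3 → Bool) (Pi.mulSingle (M := (fun a : Bool => GL {i : Fin 3 // (![false, true, true] : Fin 3 → Bool) i = a} F)) true (reindexGL e k))) : ↥(standardParabolicGL F (![false, true, true] : Fin 3 → Bool))) : GL (Fin 3) F) ∈ (unipotentRadicalGL F (id : Fin 3 → Fin 3) ⊓ standardLeviGL F ![false, true, true]) := hh ▸ h.2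
    refine ⟨(⟨k, hkU⟩, x), ?_⟩
    have hθ : (θ'.comp (Subgroup.inclusion hR)) h = whittakerChar ψ ⟨k, hkU⟩ := by
      rw [← hval ⟨k, hkU⟩ hmem]
      congr 1
      exact Subtype.ext hh
    show V (((leviEmbeddingP F (![false, true, true] : Fin 3 → Bool) (Pi.mulSingle (M := (fun a : Bool => GL {i : Fin 3 // (![false, true, true] : Fin 3 → Bool) i = a} F)) true (reindexGL e k))) : ↥(standardParabolicGL F (![false, true, true] : Fin 3 → Bool))) : GL (Fin 3) F) x - (whittakerChar ψ ⟨k, hkU⟩ : ℂˣ) • x = V ((h : ↥(unipotentRadicalGL F (id : Fin 3 → Fin 3) ⊓ standardLeviGL F ![false, true, true])) : GL (Fin 3) F) x - ((θ'.comp (Subgroup.inclusion hR)) h : ℂˣ) • x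
    rw [hθ, ← hh]
  · rintro _ ⟨⟨k, x⟩, rfl⟩
    have hmem : (((leviEmbeddingP F (![false, true, true] : Fin 3 → Bool) (Pi.mulSingle (M := (fun a : Bool => GL {i : Fin 3 // (![false, true, true] : Fin 3 → Bool) i = a} F)) true (reindexGL e (k : GL (Fin 2) F)))) : ↥(standardParabolicGL F (![false, true, true] : Fin 3 → Bool))) : GL (Fin 3) F) ∈ (unipotentRadicalGL F (id : Fin 3 → Fin 3) ⊓ standardLeviGL F ![false, true, true]) := blockEmbedding_mem_rootGroup e he (k : GL (Fin 2) F) k.2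
    refine ⟨(⟨_, hmem⟩, x), ?_⟩
    show V (((leviEmbeddingP F (![false, true, true] : Fin 3 → Bool) (Pi.mulSingle (M := (fun a : Bool => GL {i : Fin 3 // (![false, true, true] : Fin 3 → Bool) i = a} F)) true (reindexGL e (k : GL (Fin 2) F)))) : ↥(standardParabolicGL F (![false, true, true] : Fin 3 → Bool))) : GL (Fin 3) F) x - ((θ'.comp (Subgroup.inclusion hR)) ⟨_, hmem⟩ : ℂˣ) • x = V (((leviEmbeddingP F (![false, true, true] : Fin 3 → Bool) (Pi.mulSingle (M := (fun a : Bool => GL {i : Fin 3 // (![false, true, true] : Fin 3 → Bool) i = a} F)) true (reindexGL e (k : GL (Fin 2) F)))) : ↥(standardParabolicGL F (![false, true, true] : Fin 3 → Bool))) : GL (Fin 3) F) x - (whittakerChar ψ k : ℂˣ) • x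
    rw [hval k hmem]

/-- **The `(U₂,ψ)`-kernel of `W′ = r_{Q′} V ∘ ι′` is the image of `⟨V(ι′ k) x − ψ_U(k) x⟩` in `r_{Q′} V`** (★ BRIDGE′: `W′(k)[x] = [V(ι′ k) x]`, no `δ`).
[cite: BernsteinZelevinskyASENS1977, §1.8 (b), §1.9 (c)] -/
theorem map_mk_span_eq_ker_whittakerTwist :
    Submodule.map (Coinvariants.mk (restrictUnipotentGL F (![false, true, true] : Fin 3 → Bool) V)) (Submodule.span ℂ (Set.range fun p : ↥(upperUnitriangular (Fin 2) F) × X => V (((leviEmbeddingP F (![false, true, true] : Fin 3 → Bool) (Pi.mulSingle (M := (fun a : Bool => GL {i : Fin 3 // (![false, true, true] : Fin 3 → Bool) i = a} F)) true (reindexGL e (p.1 : GL (Fin 2) F)))) : ↥(standardParabolicGL F (![false, true, true] : Fin 3 → Bool))) : GL (Fin 3) F) p.2 - (whittakerChar ψ p.1 : ℂˣ) • p.2)) =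
      Coinvariants.ker (whittakerTwist ((normalizedJacquetGL F (![false, true, true] : Fin 3 → Bool) V).comp ((MonoidHom.mulSingle (fun a : Bool => GL {i : Fin 3 // (![false, true, true] : Fin 3 → Bool) i = a} F) true).comp (reindexGL e).toMonoidHom) : Representation ℂ (GL (Fin 2) F) (restrictUnipotentGL F (![false, true, true] : Fin 3 → Bool) V).Coinvariants) ψ) := by
  have hW : ∀ (k : ↥(upperUnitriangular (Fin 2) F)) (x : X), ((normalizedJacquetGL F (![false, true, true] : Fin 3 → Bool) V).comp ((MonoidHom.mulSingle (fun a : Bool => GL {i : Fin 3 // (![false, true, true] : Fin 3 → Bool) i = a} F) true).comp (reindexGL e).toMonoidHom) : Representation ℂ (GL (Fin 2) F) (restrictUnipotentGL F (![false, true, true] : Fin 3 → Bool) V).Coinvariants) (k : GL (Fin 2) F) (Coinvariants.mk (restrictUnipotentGL F (![false, true, true] : Fin 3 → Bool) V) x) =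
      Coinvariants.mk (restrictUnipotentGL F (![false, true, true] : Fin 3 → Bool) V) (V (((leviEmbeddingP F (![false, true, true] : Fin 3 → Bool) (Pi.mulSingle (M := (fun a : Bool => GL {i : Fin 3 // (![false, true, true] : Fin 3 → Bool) i = a} F)) true (reindexGL e (k : GL (Fin 2) F)))) : ↥(standardParabolicGL F (![false, true, true] : Fin 3 → Bool))) : GL (Fin 3) F) x) := fun k x => by
    have hk : (k : GL (Fin 2) F) ∈ unipotentRadicalGL F (id : Fin 2 → Fin 2) := k.2
    exact normalizedJacquetGL_blockEmbedding_mk_of_mem_unipotentRadicalGL e V (k : GL (Fin 2) F) hk x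
  rw [whittakerTwist, ker_charTwist_eq_span, Submodule.map_span]
  refine le_antisymm (Submodule.span_mono ?_) (Submodule.span_le.2 ?_)
  · rintro _ ⟨_, ⟨⟨k, x⟩, rfl⟩, rfl⟩
    refine ⟨(k, Coinvariants.mk (restrictUnipotentGL F (![false, true, true] : Fin 3 → Bool) V) x), ?_⟩
    show ((normalizedJacquetGL F (![false, true, true] : Fin 3 → Bool) V).comp ((MonoidHom.mulSingle (fun a : Bool => GL {i : Fin 3 // (![false, true, true] : Fin 3 → Bool) i = a} F) true).comp (reindexGL e).toMonoidHom) : Representation ℂ (GL (Fin 2) F) (restrictUnipotentGL F (![false, true, true] : Fin 3 → Bool) V).Coinvariants) (k : GL (Fin 2) F) (Coinvariants.mk (restrictUnipotentGL F (![false, true, true] : Fin 3 → Bool) V) x) - (whittakerChar ψ k : ℂˣ) • Coinvariants.mk (restrictUnipotentGL F (![false, true, true] : Fin 3 → Bool) V) x = _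
    rw [hW, map_sub, Units.smul_def, Units.smul_def, map_smul]
  · rintro _ ⟨⟨k, w⟩, rfl⟩
    obtain ⟨x, rfl⟩ := Coinvariants.mk_surjective _ w
    refine Submodule.subset_span ⟨_, ⟨⟨k, x⟩, rfl⟩, ?_⟩
    show Coinvariants.mk (restrictUnipotentGL F (![false, true, true] : Fin 3 → Bool) V) (V (((leviEmbeddingP F (![false, true, true] : Fin 3 → Bool) (Pi.mulSingle (M := (fun a : Bool => GL {i : Fin 3 // (![false, true, true] : Fin 3 → Bool) i = a} F)) true (reindexGL e (k : GL (Fin 2) F)))) : ↥(standardParabolicGL F (![false, true, true] : Fin 3 → Bool))) : GL (Fin 3) F) x - (whittakerChar ψ k : ℂˣ) • x) = ((normalizedJacquetGL F (![false, true, true] : Fin 3 → Bool) V).comp ((MonoidHom.mulSingle (fun a : Bool => GL {i : Fin 3 // (![false, true, true] : Fin 3 → Bool) i = a} F) true).comp (reindexGL e).toMonoidHom) : Representation ℂ (GL (Fin 2) F) (restrictUnipotentGL F (![false, true, true] : Fin 3 → Bool) V).Coinvariants) (k : GL (Fin 2) F) (Coinvariants.mk (restrictUnipotentGL F (![false, true,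 true] : Fin 3 → Bool) V) x) - (whittakerChar ψ k : ℂˣ) • Coinvariants.mk (restrictUnipotentGL F (![false, true, true] : Fin 3 → Bool) V) x
    rw [hW, map_sub, Units.smul_def, Units.smul_def, map_smul]

/-! ## §3 The criterion -/

include he in
/-- **STAGES-θ′ CRITERION: `V` is `ψ′`-degenerate iff the `GL₂`-part of `r_{Q′} V` is `ψ`-degenerate.**  For any representation `V` of `GL₃(F)` and any character `θ′` of `U₃` with
`θ′(u) = ψ(u₁₂)` (the character of ★ (lev) p859300): `(∀ v, [v]_{U₃,θ′} = 0) ↔ (∀ w, [w]_{U₂,ψ} = 0)`, the right-hand side in ★ BRIDGE′'s `W′ = (normalizedJacquetGL F c′ V) ∘ ι′`.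
[cite: BernsteinZelevinskyASENS1977, §1.8 (b), §1.9 (c)] [cite: Zelevinsky1980, §3.7] -/
theorem forall_mk_charTwist_eq_zero_iff_whittaker_gl2' (θ' : ↥(upperUnitriangular (Fin 3) F) →* ℂˣ)
    (hθ' : ∀ u, ((θ' u : ℂˣ) : ℂ) = ψ (((u : GL (Fin 3) F) : Matrix (Fin 3) (Fin 3) F) 1 2)) :
    (∀ v, Coinvariants.mk (V.charTwist (upperUnitriangular (Fin 3) F) θ') v = 0) ↔ ∀ w, Coinvariants.mk (whittakerTwist ((normalizedJacquetGL F (![false, true, true] : Fin 3 → Bool) V).comp ((MonoidHom.mulSingle (fun a : Bool => GL {i : Fin 3 // (![false, true, true] : Fin 3 → Bool) i = a} F) true).comp (reindexGL e).toMonoidHom) : Representation ℂ (GL (Fin 2) F) (restrictUnipotentGL F (![false, true, true] : Fin 3 → Bool) V).Coinvariants) ψ) w = 0 := by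
  have hL : (∀ v, Coinvariants.mk (V.charTwist (upperUnitriangular (Fin 3) F) θ') v = 0) ↔ Coinvariants.ker (V.charTwist (upperUnitriangular (Fin 3) F) θ') = ⊤ :=
    ⟨fun h => eq_top_iff.2 fun v _ => (Coinvariants.mk_eq_zero _).1 (h v), fun h v => (Coinvariants.mk_eq_zero _).2 (h ▸ Submodule.mem_top)⟩
  have hRt : (∀ w, Coinvariants.mk (whittakerTwist ((normalizedJacquetGL F (![false, true, true] : Fin 3 → Bool) V).comp ((MonoidHom.mulSingle (fun a : Bool => GL {i : Fin 3 // (![false, true, true] : Fin 3 → Bool) i = a} F) true).comp (reindexGL e).toMonoidHom) : Representation ℂ (GL (Fin 2) F) (restrictUnipotentGL F (![false, true, true] : Fin 3 → Bool) V).Coinvariants) ψ) w = 0) ↔ Coinvariants.ker (whittakerTwist ((normalizedJacquetGL F (![false, true, true] : Fin 3 → Bool) V).comp ((MonoidHom.mulSingle (fun a : Bool => GL {i : Fin 3 // (![false, true, true] : Fin 3 → Bool) i = a} F) true).comp (reindexGL e).toMonoidHom) : Representation ℂ (GL (Fin 2) F) (restrictUnipotentGL F (![false, true, true] : Fin 3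 → Bool) V).Coinvariants) ψ) = ⊤ :=
    ⟨fun h => eq_top_iff.2 fun w _ => (Coinvariants.mk_eq_zero _).1 (h w), fun h w => (Coinvariants.mk_eq_zero _).2 (h ▸ Submodule.mem_top)⟩
  rw [hL, hRt]
  have hS : (unipotentRadicalGL F (![false, true, true] : Fin 3 → Bool)) ≤ (upperUnitriangular (Fin 3) F) := unipotentRadical12_le
  have hR : (unipotentRadicalGL F (id : Fin 3 → Fin 3) ⊓ standardLeviGL F ![false, true, true]) ≤ (upperUnitriangular (Fin 3) F) := fun g hg => hg.1
  -- `θ′ |_{U_{Q′}} = 1`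
  have h1 : θ'.comp (Subgroup.inclusion hS) = 1 := MonoidHom.ext fun u => Units.ext (by
    rw [MonoidHom.comp_apply, hθ', MonoidHom.one_apply, Units.val_one]
    have h12 : (((Subgroup.inclusion hS u : ↥(upperUnitriangular (Fin 3) F)) : GL (Fin 3) F) : Matrix (Fin 3) (Fin 3) F) 1 2 = 0 := ((mem_unipotentRadical12_iff _).1 u.2).2
    rw [h12, AddChar.map_zero_eq_one, Circle.coe_one])
  have hQ : Coinvariants.ker (V.charTwist (unipotentRadicalGL F (![false, true, true] : Fin 3 → Bool)) (θ'.comp (Subgroup.inclusion hS))) = Coinvariants.ker (restrictUnipotentGL F (![false, true, true] : Fin 3 → Bool) V) := by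
    rw [ker_restrictUnipotentGL_eq_ker_comp_subtype, ker_charTwist_eq_span]
    refine le_antisymm (Submodule.span_mono ?_) (Submodule.span_mono ?_)
    · rintro _ ⟨⟨u, x⟩, rfl⟩
      refine ⟨(u, x), ?_⟩
      show (V.comp (unipotentRadicalGL F (![false, true, true] : Fin 3 → Bool)).subtype) u x - x = V (u : GL (Fin 3) F) x - ((θ'.comp (Subgroup.inclusion hS)) u : ℂˣ) • x
      rw [h1, MonoidHom.one_apply, one_smul]
      rfl
    · rintro _ ⟨⟨u, x⟩, rfl⟩
      refine ⟨(u, x), ?_⟩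
      show V (u : GL (Fin 3) F) x - ((θ'.comp (Subgroup.inclusion hS)) u : ℂˣ) • x = (V.comp (unipotentRadicalGL F (![false, true, true] : Fin 3 → Bool)).subtype) u x - x
      rw [h1, MonoidHom.one_apply, one_smul]
      rfl
  rw [ker_charTwist_eq_sup V (upperUnitriangular (Fin 3) F) (unipotentRadicalGL F (![false, true, true] : Fin 3 → Bool)) (unipotentRadicalGL F (id : Fin 3 → Fin 3) ⊓ standardLeviGL F ![false, true, true]) hS hR unipotentRadical12_sup_rootGroup_eq θ', hQ, ker_charTwist_rootGroup_eq_span e he V θ' hθ' hR,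
    ← map_mk_span_eq_ker_whittakerTwist e V]
  have hker : LinearMap.ker (Coinvariants.mk (restrictUnipotentGL F (![false, true, true] : Fin 3 → Bool) V)) = Coinvariants.ker (restrictUnipotentGL F (![false, true, true] : Fin 3 → Bool) V) := Submodule.ker_mkQ _
  constructor
  · intro h
    have h2 := congrArg (Submodule.map (Coinvariants.mk (restrictUnipotentGL F (![false, true, true] : Fin 3 → Bool) V))) h
    rw [Submodule.map_sup, Submodule.map_top, show Submodule.map (Coinvariants.mk (restrictUnipotentGL F (![false, true, true] : Fin 3 → Bool) V)) (Coinvariants.ker (restrictUnipotentGL F (![false, true, true] : Fin 3 → Bool) V)) = ⊥ from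
      Submodule.mkQ_map_self _, bot_sup_eq, show LinearMap.range (Coinvariants.mk (restrictUnipotentGL F (![false, true, true] : Fin 3 → Bool) V)) = ⊤ from Submodule.range_mkQ _] at h2
    exact h2
  · intro h
    have h2 := congrArg (Submodule.comap (Coinvariants.mk (restrictUnipotentGL F (![false, true, true] : Fin 3 → Bool) V))) h
    rw [Submodule.comap_map_eq, Submodule.comap_top, hker, sup_comm] at h2
    exact h2

end Kernels

end Summit.HodgeConjecture.HodgeConjecture.Cruxes.H413.K2E3GL3DegenerateStagesCriterionPrime

end
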